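import Summits.NavierStokesRegularity.NavierStokesRegularity.Theorems.EfficiencyFloorNearSaturationNearMaximiserSeqCorePythagoras
import Summits.NavierStokesRegularity.NavierStokesRegularity.Theorems.EfficiencyFloorRigidExitLadder
import HarnessLib

/-!
# Route `EfficiencyFloor`, rung `LerayFloorGap` (stmt-25164) of the `ProductionEfficiencyDecay` ladder (stmt-22866):
# the rung BY NAME from a centred local WEAK LIMIT of normalised maximising sequences + `MaximiserSetRigidity`

By-name helper file (`--supports stmt-NavierStokesRegularity-22866`). State of rung one after this hand: the landed ladder
`RigidExit.Ladder.lerayFloorGap_of_nearSaturation_of_maximiserSetRigidity` (p840570: `LerayFloorGap ⟸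
NearSaturationNearMaximiser + MaximiserSetRigidity`, `RigidExit` being PROVED, p840558) composed with
`nearSaturationNearMaximiser_of_centredLocalWeakLimit` (p841029/p841053/`…SeqCorePythagoras`: stmt-25482 ⟸ (P_w), with
non-vanishing, asymptotic Pythagoras and the weak→strong upgrade PROVED). Hence

* `lerayFloorGap_of_centredLocalWeakLimit_of_maximiserSetRigidity` — (P_w) + `MaximiserSetRigidity` (stmt-25512) ⟹
  `LerayFloorGap`, where (P_w) = «for the sharp Lu–Doering constant, every CENTRED admissible sequence with `Z = Pal = 1`,
  `S → c⋆` has a subsequence and an ADMISSIBLE `w` with local `L²` convergence of the vorticity on the centring ball, weak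
  convergence of `curl`, `D curl` tested on `w`, and the splitting `S(u_k − w) → c⋆ − S(w)`» (Rellich + Banach–Alaoglu +
  Brezis–Lieb + regularity of Lu–Doering extremisers).

REPAIR CENSUS of rung one (exact remaining, by name): (i) (P_w) [L–XL: Rellich–Kondrachov on a ball for `H¹` vorticities —
not in Mathlib; weak sequential compactness in `L²` — Mathlib has Banach–Alaoglu for `WeakDual`; Brezis–Lieb splitting of the
cubic stretching [L]; smoothness + `L²` decay of the weak limit = regularity of extremisers [XL]]; (ii) `MaximiserSetRigidity`
(stmt-25512) [bet; clause (b) reduced in the tree, clause (a) open]. HONEST FRAMING: `LerayFloorGap`, `ProductionEfficiencyDecay`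
(stmt-22866) and Navier–Stokes regularity stay OPEN; no summit statement is proved. [folklore]
-/

-- the problem directory repeats the summit name (`NavierStokesRegularity/NavierStokesRegularity`)
set_option linter.dupNamespace false

noncomputable section

namespace Summit.NavierStokesRegularity.NavierStokesRegularity.Theorems

namespace NearSaturationNearMaximiser

namespace SeqCore

open Set MeasureTheory Filter Topology Function
open scoped InnerProductSpace ENNReal
open Literature.Analysis.FluidPDE

/-- **`LerayFloorGap` ⟸ (P_w) + `MaximiserSetRigidity`**, BY NAME: rung one of the floor-constant ladder from a centred local
weak limit of normalised maximising sequences of the Lu–Doering functional (with admissible limit) and the maximiser-set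
rigidity item stmt-25512. Neither hypothesis is proved here. [folklore] -/
theorem lerayFloorGap_of_centredLocalWeakLimit_of_maximiserSetRigidity
    (HWw : ∀ c : ℝ, (0 < c ∧ (∀ v : EuclideanSpace ℝ (Fin 3) → EuclideanSpace ℝ (Fin 3), (ContDiff ℝ (⊤ : ℕ∞) v ∧
      Literature.Analysis.FluidPDE.VectorCalculus.IsDivFree v ∧ (∫⁻ x, ‖iteratedFDeriv ℝ 0 v x‖ₑ ^ 2 < ⊤) ∧
      (∫⁻ x, ‖iteratedFDeriv ℝ 1 v x‖ₑ ^ 2 < ⊤) ∧ (∫⁻ x, ‖iteratedFDeriv ℝ 2 v x‖ₑ ^ 2 < ⊤)) → (∫ x,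
      ⟪Literature.Analysis.FluidPDE.curl v x, fderiv ℝ v x (Literature.Analysis.FluidPDE.curl v x)⟫_ℝ) ≤ c *
      (∫ x, ‖Literature.Analysis.FluidPDE.curl v x‖ ^ 2) ^ (3 / 4 : ℝ) * (∫ x,
      Literature.Analysis.FluidPDE.frobeniusNormSq (fderiv ℝ (Literature.Analysis.FluidPDE.curl v) x)) ^ (3 /
      4 : ℝ)) ∧ ∀ c' : ℝ, (∀ w : EuclideanSpace ℝ (Fin 3) → EuclideanSpace ℝ (Fin 3), (ContDiff ℝ (⊤ : ℕ∞) w ∧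
      Literature.Analysis.FluidPDE.VectorCalculus.IsDivFree w ∧ (∫⁻ x, ‖iteratedFDeriv ℝ 0 w x‖ₑ ^ 2 < ⊤) ∧
      (∫⁻ x, ‖iteratedFDeriv ℝ 1 w x‖ₑ ^ 2 < ⊤) ∧ (∫⁻ x, ‖iteratedFDeriv ℝ 2 w x‖ₑ ^ 2 < ⊤)) → (∫ x,
      ⟪Literature.Analysis.FluidPDE.curl w x, fderiv ℝ w x (Literature.Analysis.FluidPDE.curl w x)⟫_ℝ) ≤ c' *
      (∫ x, ‖Literature.Analysis.FluidPDE.curl w x‖ ^ 2) ^ (3 / 4 : ℝ) * (∫ x,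
      Literature.Analysis.FluidPDE.frobeniusNormSq (fderiv ℝ (Literature.Analysis.FluidPDE.curl w) x)) ^ (3 /
      4 : ℝ)) → c ≤ c') →
      ∀ K δ : ℝ, 0 < K → 0 < δ → ∀ v : ℕ → EuclideanSpace ℝ (Fin 3) → EuclideanSpace ℝ (Fin 3),
      (∀ n, ContDiff ℝ (⊤ : ℕ∞) (v n) ∧
      Literature.Analysis.FluidPDE.VectorCalculus.IsDivFree (v n) ∧ (∫⁻ x, ‖iteratedFDeriv ℝ 0 (v n) x‖ₑ ^ 2 < ⊤) ∧
      (∫⁻ x, ‖iteratedFDeriv ℝ 1 (v n) x‖ₑ ^ 2 < ⊤) ∧ (∫⁻ x, ‖iteratedFDeriv ℝ 2 (v n) x‖ₑ ^ 2 < ⊤)) →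
      (∀ n, (∫ x, ‖Literature.Analysis.FluidPDE.curl (v n) x‖ ^ 2) = 1) →
      (∀ n, (∫ x, Literature.Analysis.FluidPDE.frobeniusNormSq (fderiv ℝ (Literature.Analysis.FluidPDE.curl (v n)) x)) = 1) →
      Tendsto (fun n => ∫ x, ⟪Literature.Analysis.FluidPDE.curl (v n) x, fderiv ℝ (v n) x
        (Literature.Analysis.FluidPDE.curl (v n) x)⟫_ℝ) atTop (𝓝 c) →
      (∀ᶠ n in atTop, δ ≤ ∫ x in Metric.ball (0 : EuclideanSpace ℝ (Fin 3)) K, ‖Literature.Analysis.FluidPDE.curl (v n) x‖ ^ 2) →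
      ∃ w : EuclideanSpace ℝ (Fin 3) → EuclideanSpace ℝ (Fin 3), (ContDiff ℝ (⊤ : ℕ∞) w ∧
        Literature.Analysis.FluidPDE.VectorCalculus.IsDivFree w ∧ (∫⁻ x, ‖iteratedFDeriv ℝ 0 w x‖ₑ ^ 2 < ⊤) ∧
        (∫⁻ x, ‖iteratedFDeriv ℝ 1 w x‖ₑ ^ 2 < ⊤) ∧ (∫⁻ x, ‖iteratedFDeriv ℝ 2 w x‖ₑ ^ 2 < ⊤)) ∧
        ∃ φ : ℕ → ℕ, StrictMono φ ∧
        Tendsto (fun k => ∫ x in Metric.ball (0 : EuclideanSpace ℝ (Fin 3)) K,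
          ‖Literature.Analysis.FluidPDE.curl (v (φ k) - w) x‖ ^ 2) atTop (𝓝 0) ∧
        Tendsto (fun k => ∫ x, ⟪Literature.Analysis.FluidPDE.curl (v (φ k)) x, Literature.Analysis.FluidPDE.curl w x⟫_ℝ)
          atTop (𝓝 (∫ x, ‖Literature.Analysis.FluidPDE.curl w x‖ ^ 2)) ∧
        Tendsto (fun k => ∫ x, ∑ i, ⟪fderiv ℝ (Literature.Analysis.FluidPDE.curl (v (φ k))) x (EuclideanSpace.basisFun (Fin 3) ℝ i),
          fderiv ℝ (Literature.Analysis.FluidPDE.curl w) x (EuclideanSpace.basisFun (Fin 3) ℝ i)⟫_ℝ) atTop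
          (𝓝 (∫ x, Literature.Analysis.FluidPDE.frobeniusNormSq (fderiv ℝ (Literature.Analysis.FluidPDE.curl w) x))) ∧
        Tendsto (fun k => ∫ x, ⟪Literature.Analysis.FluidPDE.curl (v (φ k) - w) x, fderiv ℝ (v (φ k) - w) x
          (Literature.Analysis.FluidPDE.curl (v (φ k) - w) x)⟫_ℝ) atTop
          (𝓝 (c - ∫ x, ⟪Literature.Analysis.FluidPDE.curl w x, fderiv ℝ w x (Literature.Analysis.FluidPDE.curl w x)⟫_ℝ)))
    (hM : Summit.NavierStokesRegularity.NavierStokesRegularity.Theses.EfficiencyFloor.MaximiserSetRigidity) :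
    Summit.NavierStokesRegularity.NavierStokesRegularity.Theses.EfficiencyFloor.LerayFloorGap :=
  RigidExit.Ladder.lerayFloorGap_of_nearSaturation_of_maximiserSetRigidity
    (nearSaturationNearMaximiser_of_centredLocalWeakLimit HWw) hM

end SeqCore

end NearSaturationNearMaximiser

end Summit.NavierStokesRegularity.NavierStokesRegularity.Theorems

end
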